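import Summits.QuantumFields.BalabanUV.Beta.GAN24.SecondOrderBoundedTraces

/-!
# `BalabanUV.Beta.GAN24.SecondOrderRatioSockets` — binder row G-an2-4 ∕ (CONV-C), routes C-R6° («VALUES») × R7 («TWO CURRENCIES»), PART 231:
# PART 208 ∕ 214's THREE KERNEL-PAIR SOCKETS `Γ₁(Y ⊗ₖ Yᵀ)Γ₂ᴴ`, `Γ₁(c⁻¹ ⊗ₖ Yᵀ)Γ₂ᴴ`, `Γ₁(Y ⊗ₖ (c⁻¹)ᵀ)Γ₂ᴴ` AT ANY STEP RATIO `θ ≥ √(L⁻¹)` — the loop covariance's and `c⁻¹`'s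
# (SR) at `√(L⁻¹)` is one at every larger ratio (`twoLevelDecayRate_of_le_ratio`); needed by the almost nested legs of census V204′ (ii), whose step ratio is `L^{−1∕4}`
# (unit b2b-balaban-gan24-p3, gen 64; v1)

NOT IN PRINT; OUR PROOF (PART 214 §1 VERBATIM with `1` replaced by `θ`; [folklore] bookkeeping BY NAME over PART 208 (`inputs_twoKernel_of_bundles`), PART 206 (`inputs_transpose`),
PART 195 (`exists_loopCov_inputs`, `inv_unitCovB_inputs`, `twoLevelDecayRate_of_le_ratio`), PART 130 (`twoLevelDecayRate_const_nonneg`); [Balaban1987RG1] (1.20)–(1.22) p. 264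
LOCATE the one-loop shapes; nothing printed is a hypothesis).
HONEST FRAMING (cell contract, verbatim): «discharging `BetaPertH` makes Bałaban's UV stability UNCONDITIONAL — a real constructive-QFT result; it is NOT the
continuum limit and NOT the Clay problem.»  HONEST DEPENDENCY (verbatim): «continuum YM on T⁴ ⇐ BetaPertH ∧ nine spine estimates (0/9 proved); BetaPertH ⇐
(D1) ∧ (D4) ∧ CAP+tail; G-an2-4 gates asym, D1 and NE2/3/4.»

WHAT THIS FILE PROVES (0 sorry, 0 `def`; notation of PART 208; dimension `d + 1 ≥ 2`, `L ≥ 2`, every `Lb`, `a > 0`, every cubic coarse volume sequence; legs GENERIC at a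
prescribed rate `κ_Γ` with step envelopes `γᵢ′θ^k`, EL₃ displayed): **`inputs_loopLoopT_moving_of_ratio`**, **`inputs_invLoopT_moving_of_ratio`**, **`inputs_loopInvT_moving_of_ratio`** —
the socket towers are ratio-`θ` input bundles `(γ₁γ₂C, (γ₁′γ₂ + γ₁γ₂′)C + γ₁γ₂C′, κ₁∕4, θ)`.
WHAT IT DOES NOT DO: discharge any legs.  SUPPLIER work; NEVER «G-an2-4 closed»; NOT (CONV-C), NOT D1, NOT `BetaPertH`, NOT continuum, NOT Clay.
Records: `HOME/b2b-balaban-gan24-p3/gen64/README.md`.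
-/

noncomputable section

open scoped BigOperators ComplexConjugate Matrix Matrix.Norms.L2Operator Kronecker
open Filter Topology Finset Matrix

namespace Summit.QuantumFields.BalabanUV.Beta.GAN24.SecondOrderRatioSockets

open Literature.MathematicalPhysics.QuantumFieldTheory.Balaban1983to89
open Literature.MathematicalPhysics.QuantumFieldTheory.Balaban1983to89.B5Prop11Plancherel (Tor fine)
open Literature.MathematicalPhysics.QuantumFieldTheory.Balaban1983to89.B5RealFields (reM)
open Literature.MathematicalPhysics.QuantumFieldTheory.Balaban1983to89.B5G183RateUnitTower (lev)
open Literature.MathematicalPhysics.QuantumFieldTheory.Balaban1983to89.Beta (Site windowMap)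
open Literature.MathematicalPhysics.QuantumFieldTheory.Balaban1983to89.Beta.FreeLegDictionary (cubic)
open Literature.MathematicalPhysics.QuantumFieldTheory.Balaban1983to89.Beta.BlockKernelVolumeSockets (evenPeriod tendsto_evenPeriod)
open Literature.MathematicalPhysics.QuantumFieldTheory.Balaban1983to89.Beta.VectorTails (castT)
open Literature.MathematicalPhysics.QuantumFieldTheory.Balaban1983to89.Beta.CompositionSingular (flucCov)
open Literature.MathematicalPhysics.QuantumFieldTheory.Balaban1983to89.Beta.BlockEffectiveAction (DelK)
open Summit.QuantumFields.BalabanUV.T4Continuum.BalabanLineAverage (QB)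
open Summit.QuantumFields.BalabanUV.T4Continuum.BalabanAveragedTowerModes (par rem)
open Summit.QuantumFields.BalabanUV.T4Continuum.CovariantAveragingTower (avgTow)
open Summit.QuantumFields.BalabanUV.T4Continuum.BalabanAveragedTowerUnit (idx QBlev calGlev unitCovB one_le_lev')
open Summit.QuantumFields.BalabanUV.T4Continuum.BalabanAveragedCoerciveTower (unitIdx)
open Summit.QuantumFields.BalabanUV.T4Continuum.CTKingTowerWeights (rho distK)
open Summit.QuantumFields.BalabanUV.T4Continuum.FirstOrderBackgroundModel (LipschitzBackground Pmodel)
open Summit.QuantumFields.BalabanUV.T4Continuum.DecayRateInterpolation (EntryDecay TwoLevelDecayRate)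
open Summit.QuantumFields.BalabanUV.Beta.GAN24.DiagramDecayAlgebra (twoLevelDecayRate_const_nonneg)
open Summit.QuantumFields.BalabanUV.Beta.GAN24.UnitLatticeDecayAlgebra (distK_nonneg)
open Summit.QuantumFields.BalabanUV.Beta.GAN24.OneStepLoopCovarianceInputTriple (exists_loopCov_inputs inv_unitCovB_inputs twoLevelDecayRate_of_le_ratio)
open Summit.QuantumFields.BalabanUV.Beta.GAN24.SecondOrderInputsLinear (inputs_transpose)
open Summit.QuantumFields.BalabanUV.Beta.GAN24.SecondOrderLiteralTraces (inputs_twoKernel_of_bundles)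

variable {d : ℕ} (L : ℕ) [NeZero L]

/-! ## §1 The three kernel pairs with ratio-`θ` legs, every cubic coarse volume sequence -/

section Moving

variable (Lb : ℕ) [NeZero Lb] (a : ℝ) (ha : 0 < a) (s : ℕ → ℕ) [hs0 : ∀ t, NeZero (s t)]

/-- **`inputs_loopLoopT_moving_of_ratio` — THE SOCKET `Γ₁(Y ⊗ₖ Yᵀ)Γ₂ᴴ` OF THE ONE-LOOP STEP WITH LEVEL-DEPENDENT LEGS OF STEP RATIO `θ` IS A RATIO-`θ` INPUT BUNDLE** (dimension
`d + 1 ≥ 2`, `L ≥ 2`, every `Lb ≥ 1`, `a > 0`, every cubic coarse volume sequence `s t → ∞`; the legs' rate `κ_Γ > 0` PRESCRIBED, their step envelope `γᵢ′·θ^k·e^{−κ_Γ(…)}`, ANY `θ ≥ √(L⁻¹)`):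
`∃ 0 < κ₁ ≤ κ_Γ`, `C, C′ ≥ 0` such that for all such legs with EL₃ the socket tower has (UD) `(γ₁γ₂C, κ₁∕4)`, (SR) `((γ₁′γ₂ + γ₁γ₂′)C + γ₁γ₂C′, κ₁∕4, θ)` and (EL) at ALL integer root
pairs — PART 208 §2 with the loop covariance's ∕ `c⁻¹`'s ratio `√(L⁻¹)` weakened to `θ`. [cite: Balaban1987RG1, (1.20)–(1.22) p.264 (shapes)] [folklore] -/
theorem inputs_loopLoopT_moving_of_ratio (hL : 2 ≤ L) (hd : 1 ≤ d) (hs : Tendsto s atTop atTop) {κΓ : ℝ} (hκΓ : 0 < κΓ) {θ : ℝ} (hθL : Real.sqrt ((L : ℝ)⁻¹) ≤ θ) :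
    ∃ κ₁ C C' : ℝ, 0 < κ₁ ∧ κ₁ ≤ κΓ ∧ 0 ≤ C ∧ 0 ≤ C' ∧ ∀ (γ₁ γ₂ γ₁' γ₂' : ℝ), 0 ≤ γ₁ → 0 ≤ γ₂ → 0 ≤ γ₁' → 0 ≤ γ₂' →
      ∀ (Γ₁ Γ₂ : (t k : ℕ) → Matrix (idx L (fine (Lb * 1) (cubic (d + 1) (s t))) 0) (idx L (fine (Lb * 1) (cubic (d + 1) (s t))) 0 × idx L (fine (Lb * 1) (cubic (d + 1) (s t))) 0) ℂ),
      (∀ t k x q, ‖Γ₁ t k x q‖ ≤ γ₁ * Real.exp (-(κΓ * (distK L (fine (Lb * 1) (cubic (d + 1) (s t))) x q.1 + distK L (fine (Lb * 1) (cubic (d + 1) (s t))) x q.2)))) →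
      (∀ t k x q, ‖Γ₂ t k x q‖ ≤ γ₂ * Real.exp (-(κΓ * (distK L (fine (Lb * 1) (cubic (d + 1) (s t))) x q.1 + distK L (fine (Lb * 1) (cubic (d + 1) (s t))) x q.2)))) →
      (∀ t k x q, ‖(Γ₁ t (k + 1) - Γ₁ t k) x q‖ ≤ γ₁' * θ ^ k * Real.exp (-(κΓ * (distK L (fine (Lb * 1) (cubic (d + 1) (s t))) x q.1 + distK L (fine (Lb * 1) (cubic (d + 1) (s t))) x q.2)))) →
      (∀ t k x q, ‖(Γ₂ t (k + 1) - Γ₂ t k) x q‖ ≤ γ₂' * θ ^ k * Real.exp (-(κΓ * (distK L (fine (Lb * 1) (cubic (d + 1) (s t))) x q.1 + distK L (fine (Lb * 1) (cubic (d + 1) (s t))) x q.2)))) →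
      (∀ k (μ' l l' : Fin (d + 1)) (z u v : Fin (d + 1) → ℤ), ∃ s' : ℂ, Tendsto (fun t => Γ₁ t k ((unitIdx L (fine (Lb * 1) (cubic (d + 1) (s t)))).symm (castT (fine (Lb * 1) (cubic (d + 1) (s t))) z, μ')) (((unitIdx L (fine (Lb * 1) (cubic (d + 1) (s t)))).symm (castT (fine (Lb * 1) (cubic (d + 1) (s t))) u, l)), ((unitIdx L (fine (Lb * 1) (cubic (d + 1) (s t)))).symm (castT (fine (Lb * 1) (cubic (d + 1) (s t))) v, l')))) atTop (𝓝 s')) →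
      (∀ k (μ' l l' : Fin (d + 1)) (z u v : Fin (d + 1) → ℤ), ∃ s' : ℂ, Tendsto (fun t => Γ₂ t k ((unitIdx L (fine (Lb * 1) (cubic (d + 1) (s t)))).symm (castT (fine (Lb * 1) (cubic (d + 1) (s t))) z, μ')) (((unitIdx L (fine (Lb * 1) (cubic (d + 1) (s t)))).symm (castT (fine (Lb * 1) (cubic (d + 1) (s t))) u, l)), ((unitIdx L (fine (Lb * 1) (cubic (d + 1) (s t)))).symm (castT (fine (Lb * 1) (cubic (d + 1) (s t))) v, l')))) atTop (𝓝 s')) →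
      (∀ t k, EntryDecay (distK L (fine (Lb * 1) (cubic (d + 1) (s t)))) (Γ₁ t k * ((((unitCovB L (fine (Lb * 1) (cubic (d + 1) (s t))) a ha k)⁻¹ * (((flucCov (reM (DelK (lev L k) (one_le_lev' L k) (fine (Lb * 1) (cubic (d + 1) (s t))) a ha)) (Matrix.fromRows (reM (QB 1 Lb (cubic (d + 1) (s t)))) (fun (t' : {x : Tor (fine (Lb * 1) (cubic (d + 1) (s t))) × Fin (d + 1) // (∀ ν, ν < x.2 → ((rem 1 Lb (cubic (d + 1) (s t)) x.1 ν : ℕ)) = 0) ∧ ((rem 1 Lb (cubic (d + 1) (s t)) x.1 x.2 : ℕ)) + 1 < Lb}) (x : Tor (fine (Lb * 1) (cubic (d + 1) (s t))) × Fin (d + 1)) => if x = (Function.Embedding.subtype (fun x : Tor (fine (Lb * 1) (cubic (d + 1) (s t))) × Fin (d + 1) => (∀ ν, ν < x.2 → ((rem 1 Lb (cubic (d + 1) (s t)) x.1 ν : ℕ)) = 0) ∧ ((rem 1 Lb (cubic (d + 1) (s t)) x.1 x.2 : ℕ)) + 1 < Lb)) t' then (1 : ℝ) else 0))).map ((↑)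 : ℝ → ℂ)).submatrix (unitIdx L (fine (Lb * 1) (cubic (d + 1) (s t)))) (unitIdx L (fine (Lb * 1) (cubic (d + 1) (s t))))) * (unitCovB L (fine (Lb * 1) (cubic (d + 1) (s t))) a ha k)⁻¹)) ⊗ₖ (((unitCovB L (fine (Lb * 1) (cubic (d + 1) (s t))) a ha k)⁻¹ * (((flucCov (reM (DelK (lev L k) (one_le_lev' L k) (fine (Lb * 1) (cubic (d + 1) (s t))) a ha)) (Matrix.fromRows (reM (QB 1 Lb (cubic (d + 1) (s t)))) (fun (t' : {x : Tor (fine (Lb * 1) (cubic (d + 1) (s t))) × Fin (d + 1) // (∀ ν, ν < x.2 → ((rem 1 Lb (cubic (d + 1) (s t)) x.1 ν : ℕ)) = 0) ∧ ((rem 1 Lb (cubic (d + 1) (s t)) x.1 x.2 : ℕ)) + 1 < Lb}) (x : Tor (fine (Lb * 1) (cubic (d + 1) (s t))) × Fin (d + 1)) => if x = (Function.Embedding.subtype (fun x : Tor (fine (Lb * 1) (cubic (d + 1) (s t))) × Fin (d + 1) => (∀ ν, ν < x.2 → ((rem 1 Lb (cubic (d + 1) (s t)) x.1 ν : ℕ))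 = 0) ∧ ((rem 1 Lb (cubic (d + 1) (s t)) x.1 x.2 : ℕ)) + 1 < Lb)) t' then (1 : ℝ) else 0))).map ((↑) : ℝ → ℂ)).submatrix (unitIdx L (fine (Lb * 1) (cubic (d + 1) (s t)))) (unitIdx L (fine (Lb * 1) (cubic (d + 1) (s t))))) * (unitCovB L (fine (Lb * 1) (cubic (d + 1) (s t))) a ha k)⁻¹))ᵀ) * (Γ₂ t k)ᴴ) (γ₁ * γ₂ * C) (κ₁ / 4)) ∧
      (∀ t, TwoLevelDecayRate (distK L (fine (Lb * 1) (cubic (d + 1) (s t)))) (fun k => Γ₁ t k * ((((unitCovB L (fine (Lb * 1) (cubic (d + 1) (s t))) a ha k)⁻¹ * (((flucCov (reM (DelK (lev L k) (one_le_lev' L k) (fine (Lb * 1) (cubic (d + 1) (s t))) a ha)) (Matrix.fromRows (reM (QB 1 Lb (cubic (d + 1) (s t)))) (fun (t' : {x : Tor (fine (Lb * 1) (cubic (d + 1) (s t))) × Fin (d + 1) // (∀ ν, ν < x.2 → ((rem 1 Lb (cubic (d + 1) (s t)) x.1 ν : ℕ)) = 0) ∧ ((rem 1 Lb (cubic (d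 + 1) (s t)) x.1 x.2 : ℕ)) + 1 < Lb}) (x : Tor (fine (Lb * 1) (cubic (d + 1) (s t))) × Fin (d + 1)) => if x = (Function.Embedding.subtype (fun x : Tor (fine (Lb * 1) (cubic (d + 1) (s t))) × Fin (d + 1) => (∀ ν, ν < x.2 → ((rem 1 Lb (cubic (d + 1) (s t)) x.1 ν : ℕ)) = 0) ∧ ((rem 1 Lb (cubic (d + 1) (s t)) x.1 x.2 : ℕ)) + 1 < Lb)) t' then (1 : ℝ) else 0))).map ((↑) : ℝ → ℂ)).submatrix (unitIdx L (fine (Lb * 1) (cubic (d + 1) (s t)))) (unitIdx L (fine (Lb * 1) (cubic (d + 1) (s t))))) * (unitCovB L (fine (Lb * 1) (cubic (d + 1) (s t))) a ha k)⁻¹)) ⊗ₖ (((unitCovB L (fine (Lb * 1) (cubic (d + 1) (s t))) a ha k)⁻¹ * (((flucCov (reM (DelK (lev L k) (one_le_lev' L k) (fine (Lb * 1) (cubic (d + 1) (s t))) a ha)) (Matrix.fromRows (reM (QB 1 Lb (cubic (d + 1) (s t)))) (fun (t' : {x : Tor (fine (Lb * 1) (cubic (d + 1) (s t))) × Fin (d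 + 1) // (∀ ν, ν < x.2 → ((rem 1 Lb (cubic (d + 1) (s t)) x.1 ν : ℕ)) = 0) ∧ ((rem 1 Lb (cubic (d + 1) (s t)) x.1 x.2 : ℕ)) + 1 < Lb}) (x : Tor (fine (Lb * 1) (cubic (d + 1) (s t))) × Fin (d + 1)) => if x = (Function.Embedding.subtype (fun x : Tor (fine (Lb * 1) (cubic (d + 1) (s t))) × Fin (d + 1) => (∀ ν, ν < x.2 → ((rem 1 Lb (cubic (d + 1) (s t)) x.1 ν : ℕ)) = 0) ∧ ((rem 1 Lb (cubic (d + 1) (s t)) x.1 x.2 : ℕ)) + 1 < Lb)) t' then (1 : ℝ) else 0))).map ((↑) : ℝ → ℂ)).submatrix (unitIdx L (fine (Lb * 1) (cubic (d + 1) (s t)))) (unitIdx L (fine (Lb * 1) (cubic (d + 1) (s t))))) * (unitCovB L (fine (Lb * 1) (cubic (d + 1) (s t))) a ha k)⁻¹))ᵀ) * (Γ₂ t k)ᴴ) (((γ₁' * γ₂ + γ₁ * γ₂') * C + γ₁ * γ₂ * C')) (κ₁ / 4) θ) ∧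
      (∀ k (μ ν : Fin (d + 1)) (z z' : Fin (d + 1) → ℤ), ∃ s' : ℂ, Tendsto (fun t => (Γ₁ t k * ((((unitCovB L (fine (Lb * 1) (cubic (d + 1) (s t))) a ha k)⁻¹ * (((flucCov (reM (DelK (lev L k) (one_le_lev' L k) (fine (Lb * 1) (cubic (d + 1) (s t))) a ha)) (Matrix.fromRows (reM (QB 1 Lb (cubic (d + 1) (s t)))) (fun (t' : {x : Tor (fine (Lb * 1) (cubic (d + 1) (s t))) × Fin (d + 1) // (∀ ν, ν < x.2 → ((rem 1 Lb (cubic (d + 1) (s t)) x.1 ν : ℕ)) = 0) ∧ ((rem 1 Lb (cubic (d + 1) (s t)) x.1 x.2 : ℕ)) + 1 < Lb}) (x : Tor (fine (Lb * 1) (cubic (d + 1) (s t))) × Fin (d + 1)) => if x = (Function.Embedding.subtype (fun x : Tor (fine (Lb * 1) (cubic (d + 1) (s t))) × Fin (d + 1) => (∀ ν, ν < x.2 → ((rem 1 Lb (cubic (d + 1) (s t)) x.1 ν : ℕ)) = 0) ∧ ((rem 1 Lb (cubic (d + 1) (s t)) x.1 x.2 : ℕ)) + 1 < Lb)) t' then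 (1 : ℝ) else 0))).map ((↑) : ℝ → ℂ)).submatrix (unitIdx L (fine (Lb * 1) (cubic (d + 1) (s t)))) (unitIdx L (fine (Lb * 1) (cubic (d + 1) (s t))))) * (unitCovB L (fine (Lb * 1) (cubic (d + 1) (s t))) a ha k)⁻¹)) ⊗ₖ (((unitCovB L (fine (Lb * 1) (cubic (d + 1) (s t))) a ha k)⁻¹ * (((flucCov (reM (DelK (lev L k) (one_le_lev' L k) (fine (Lb * 1) (cubic (d + 1) (s t))) a ha)) (Matrix.fromRows (reM (QB 1 Lb (cubic (d + 1) (s t)))) (fun (t' : {x : Tor (fine (Lb * 1) (cubic (d + 1) (s t))) × Fin (d + 1) // (∀ ν, ν < x.2 → ((rem 1 Lb (cubic (d + 1) (s t)) x.1 ν : ℕ)) = 0) ∧ ((rem 1 Lb (cubic (d + 1) (s t)) x.1 x.2 : ℕ)) + 1 < Lb}) (x : Tor (fine (Lb * 1) (cubic (d + 1) (s t))) × Fin (d + 1)) => if x = (Function.Embedding.subtype (fun x : Tor (fine (Lb * 1) (cubic (d + 1) (s t))) × Fin (d + 1) => (∀ ν, ν < x.2 → ((rem 1 Lb (cubic (d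 + 1) (s t)) x.1 ν : ℕ)) = 0) ∧ ((rem 1 Lb (cubic (d + 1) (s t)) x.1 x.2 : ℕ)) + 1 < Lb)) t' then (1 : ℝ) else 0))).map ((↑) : ℝ → ℂ)).submatrix (unitIdx L (fine (Lb * 1) (cubic (d + 1) (s t)))) (unitIdx L (fine (Lb * 1) (cubic (d + 1) (s t))))) * (unitCovB L (fine (Lb * 1) (cubic (d + 1) (s t))) a ha k)⁻¹))ᵀ) * (Γ₂ t k)ᴴ) ((unitIdx L (fine (Lb * 1) (cubic (d + 1) (s t)))).symm (castT (fine (Lb * 1) (cubic (d + 1) (s t))) z, μ)) ((unitIdx L (fine (Lb * 1) (cubic (d + 1) (s t)))).symm (castT (fine (Lb * 1) (cubic (d + 1) (s t))) z', ν))) atTop (𝓝 s')) := by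
  have hd' : 2 ≤ d + 1 := by omega
  have hθ0 : 0 ≤ Real.sqrt ((L : ℝ)⁻¹) := Real.sqrt_nonneg _
  have hθ1 : 0 ≤ θ := hθ0.trans hθL
  have hside : Tendsto (fun t => Lb * 1 * s t) atTop atTop :=
    Filter.tendsto_atTop_mono (fun t => Nat.le_mul_of_pos_left _ (Nat.pos_of_ne_zero (NeZero.ne (Lb * 1)))) hs
  obtain ⟨κ₀, B₁, B₁', hκ₀, hB₁, hudY, hsrY, helY⟩ := exists_loopCov_inputs L a ha Lb s hL hd hs one_pos
  have hB₁' : 0 ≤ B₁' := by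
    haveI : Nonempty (idx L (fine (Lb * 1) (cubic (d + 1) (s 0))) 0) := ⟨(unitIdx L _).symm (0, 0)⟩
    exact twoLevelDecayRate_const_nonneg (hsrY 0)
  have hsrY1 := fun t => twoLevelDecayRate_of_le_ratio (hsrY t) hB₁' hθ0 hθL
  have hYT := inputs_transpose L (side := fun t => Lb * 1 * s t) (c := fun t k => ((unitCovB L (fine (Lb * 1) (cubic (d + 1) (s t))) a ha k)⁻¹ * (((flucCov (reM (DelK (lev L k) (one_le_lev' L k) (fine (Lb * 1) (cubic (d + 1) (s t))) a ha)) (Matrix.fromRows (reM (QB 1 Lb (cubic (d + 1) (s t)))) (fun (t' : {x : Tor (fine (Lb * 1) (cubic (d + 1) (s t))) × Fin (d + 1) // (∀ ν, ν < x.2 → ((rem 1 Lb (cubic (d + 1) (s t)) x.1 ν : ℕ)) = 0) ∧ ((rem 1 Lb (cubic (d + 1) (s t)) x.1 x.2 : ℕ)) + 1 < Lb}) (x : Tor (fine (Lb * 1) (cubic (d + 1) (s t))) × Fin (d + 1)) => if x = (Function.Embedding.subtype (fun x : Tor (fine (Lb * 1) (cubic (d + 1) (s t))) × Fin (d + 1)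 => (∀ ν, ν < x.2 → ((rem 1 Lb (cubic (d + 1) (s t)) x.1 ν : ℕ)) = 0) ∧ ((rem 1 Lb (cubic (d + 1) (s t)) x.1 x.2 : ℕ)) + 1 < Lb)) t' then (1 : ℝ) else 0))).map ((↑) : ℝ → ℂ)).submatrix (unitIdx L (fine (Lb * 1) (cubic (d + 1) (s t)))) (unitIdx L (fine (Lb * 1) (cubic (d + 1) (s t))))) * (unitCovB L (fine (Lb * 1) (cubic (d + 1) (s t))) a ha k)⁻¹)) ⟨hudY, hsrY1, helY⟩
  obtain ⟨C, C', hC, hC', h⟩ := inputs_twoKernel_of_bundles L (d := d + 1) hd' hside (K₁ := fun t k => ((unitCovB L (fine (Lb * 1) (cubic (d + 1) (s t))) a ha k)⁻¹ * (((flucCov (reM (DelK (lev L k) (one_le_lev' L k) (fine (Lb * 1) (cubic (d + 1) (s t))) a ha)) (Matrix.fromRows (reM (QB 1 Lb (cubic (d + 1) (s t)))) (fun (t' : {x : Tor (fine (Lb * 1) (cubic (d + 1) (s t))) × Fin (d + 1) // (∀ ν, ν < x.2 → ((rem 1 Lb (cubic (d + 1) (s t)) x.1 ν : ℕ)) = 0)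 ∧ ((rem 1 Lb (cubic (d + 1) (s t)) x.1 x.2 : ℕ)) + 1 < Lb}) (x : Tor (fine (Lb * 1) (cubic (d + 1) (s t))) × Fin (d + 1)) => if x = (Function.Embedding.subtype (fun x : Tor (fine (Lb * 1) (cubic (d + 1) (s t))) × Fin (d + 1) => (∀ ν, ν < x.2 → ((rem 1 Lb (cubic (d + 1) (s t)) x.1 ν : ℕ)) = 0) ∧ ((rem 1 Lb (cubic (d + 1) (s t)) x.1 x.2 : ℕ)) + 1 < Lb)) t' then (1 : ℝ) else 0))).map ((↑) : ℝ → ℂ)).submatrix (unitIdx L (fine (Lb * 1) (cubic (d + 1) (s t)))) (unitIdx L (fine (Lb * 1) (cubic (d + 1) (s t))))) * (unitCovB L (fine (Lb * 1) (cubic (d + 1) (s t))) a ha k)⁻¹)) (K₂ := fun t k => (((unitCovB L (fine (Lb * 1) (cubic (d + 1) (s t))) a ha k)⁻¹ * (((flucCov (reM (DelK (lev L k) (one_le_lev' L k) (fine (Lb * 1) (cubic (d + 1) (s t))) a ha)) (Matrix.fromRows (reM (QB 1 Lb (cubic (d + 1) (s t)))) (fun (t' : {x : Tor (fine (Lb *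 1) (cubic (d + 1) (s t))) × Fin (d + 1) // (∀ ν, ν < x.2 → ((rem 1 Lb (cubic (d + 1) (s t)) x.1 ν : ℕ)) = 0) ∧ ((rem 1 Lb (cubic (d + 1) (s t)) x.1 x.2 : ℕ)) + 1 < Lb}) (x : Tor (fine (Lb * 1) (cubic (d + 1) (s t))) × Fin (d + 1)) => if x = (Function.Embedding.subtype (fun x : Tor (fine (Lb * 1) (cubic (d + 1) (s t))) × Fin (d + 1) => (∀ ν, ν < x.2 → ((rem 1 Lb (cubic (d + 1) (s t)) x.1 ν : ℕ)) = 0) ∧ ((rem 1 Lb (cubic (d + 1) (s t)) x.1 x.2 : ℕ)) + 1 < Lb)) t' then (1 : ℝ) else 0))).map ((↑) : ℝ → ℂ)).submatrix (unitIdx L (fine (Lb * 1) (cubic (d + 1) (s t)))) (unitIdx L (fine (Lb * 1) (cubic (d + 1) (s t))))) * (unitCovB L (fine (Lb * 1) (cubic (d + 1) (s t))) a ha k)⁻¹))ᵀ)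
    hκ₀ hκ₀ hκΓ hB₁ hB₁' hB₁ hB₁' hθ1 ⟨hudY, hsrY1, helY⟩ hYT
  exact ⟨min (min κ₀ κ₀) κΓ, C, C', lt_min (lt_min hκ₀ hκ₀) hκΓ, min_le_right _ _, hC, hC', h⟩

/-- **`inputs_invLoopT_moving_of_ratio` — THE SOCKET `Γ₁(c⁻¹ ⊗ₖ Yᵀ)Γ₂ᴴ` OF THE ONE-LOOP STEP WITH LEVEL-DEPENDENT LEGS OF STEP RATIO `θ` IS A RATIO-`θ` INPUT BUNDLE** (dimension
`d + 1 ≥ 2`, `L ≥ 2`, every `Lb ≥ 1`, `a > 0`, every cubic coarse volume sequence `s t → ∞`; the legs' rate `κ_Γ > 0` PRESCRIBED, their step envelope `γᵢ′·θ^k·e^{−κ_Γ(…)}`, ANY `θ ≥ √(L⁻¹)`):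
`∃ 0 < κ₁ ≤ κ_Γ`, `C, C′ ≥ 0` such that for all such legs with EL₃ the socket tower has (UD) `(γ₁γ₂C, κ₁∕4)`, (SR) `((γ₁′γ₂ + γ₁γ₂′)C + γ₁γ₂C′, κ₁∕4, θ)` and (EL) at ALL integer root
pairs — PART 208 §2 with the loop covariance's ∕ `c⁻¹`'s ratio `√(L⁻¹)` weakened to `θ`. [cite: Balaban1987RG1, (1.20)–(1.22) p.264 (shapes)] [folklore] -/
theorem inputs_invLoopT_moving_of_ratio (hL : 2 ≤ L) (hd : 1 ≤ d) (hs : Tendsto s atTop atTop) {κΓ : ℝ} (hκΓ : 0 < κΓ) {θ : ℝ} (hθL : Real.sqrt ((L : ℝ)⁻¹) ≤ θ) :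
    ∃ κ₁ C C' : ℝ, 0 < κ₁ ∧ κ₁ ≤ κΓ ∧ 0 ≤ C ∧ 0 ≤ C' ∧ ∀ (γ₁ γ₂ γ₁' γ₂' : ℝ), 0 ≤ γ₁ → 0 ≤ γ₂ → 0 ≤ γ₁' → 0 ≤ γ₂' →
      ∀ (Γ₁ Γ₂ : (t k : ℕ) → Matrix (idx L (fine (Lb * 1) (cubic (d + 1) (s t))) 0) (idx L (fine (Lb * 1) (cubic (d + 1) (s t))) 0 × idx L (fine (Lb * 1) (cubic (d + 1) (s t))) 0) ℂ),
      (∀ t k x q, ‖Γ₁ t k x q‖ ≤ γ₁ * Real.exp (-(κΓ * (distK L (fine (Lb * 1) (cubic (d + 1) (s t))) x q.1 + distK L (fine (Lb * 1) (cubic (d + 1) (s t))) x q.2)))) →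
      (∀ t k x q, ‖Γ₂ t k x q‖ ≤ γ₂ * Real.exp (-(κΓ * (distK L (fine (Lb * 1) (cubic (d + 1) (s t))) x q.1 + distK L (fine (Lb * 1) (cubic (d + 1) (s t))) x q.2)))) →
      (∀ t k x q, ‖(Γ₁ t (k + 1) - Γ₁ t k) x q‖ ≤ γ₁' * θ ^ k * Real.exp (-(κΓ * (distK L (fine (Lb * 1) (cubic (d + 1) (s t))) x q.1 + distK L (fine (Lb * 1) (cubic (d + 1) (s t))) x q.2)))) →
      (∀ t k x q, ‖(Γ₂ t (k + 1) - Γ₂ t k) x q‖ ≤ γ₂' * θ ^ k * Real.exp (-(κΓ * (distK L (fine (Lb * 1) (cubic (d + 1) (s t))) x q.1 + distK L (fine (Lb * 1) (cubic (d + 1) (s t))) x q.2)))) →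
      (∀ k (μ' l l' : Fin (d + 1)) (z u v : Fin (d + 1) → ℤ), ∃ s' : ℂ, Tendsto (fun t => Γ₁ t k ((unitIdx L (fine (Lb * 1) (cubic (d + 1) (s t)))).symm (castT (fine (Lb * 1) (cubic (d + 1) (s t))) z, μ')) (((unitIdx L (fine (Lb * 1) (cubic (d + 1) (s t)))).symm (castT (fine (Lb * 1) (cubic (d + 1) (s t))) u, l)), ((unitIdx L (fine (Lb * 1) (cubic (d + 1) (s t)))).symm (castT (fine (Lb * 1) (cubic (d + 1) (s t))) v, l')))) atTop (𝓝 s')) →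
      (∀ k (μ' l l' : Fin (d + 1)) (z u v : Fin (d + 1) → ℤ), ∃ s' : ℂ, Tendsto (fun t => Γ₂ t k ((unitIdx L (fine (Lb * 1) (cubic (d + 1) (s t)))).symm (castT (fine (Lb * 1) (cubic (d + 1) (s t))) z, μ')) (((unitIdx L (fine (Lb * 1) (cubic (d + 1) (s t)))).symm (castT (fine (Lb * 1) (cubic (d + 1) (s t))) u, l)), ((unitIdx L (fine (Lb * 1) (cubic (d + 1) (s t)))).symm (castT (fine (Lb * 1) (cubic (d + 1) (s t))) v, l')))) atTop (𝓝 s')) →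
      (∀ t k, EntryDecay (distK L (fine (Lb * 1) (cubic (d + 1) (s t)))) (Γ₁ t k * ((unitCovB L (fine (Lb * 1) (cubic (d + 1) (s t))) a ha k)⁻¹ ⊗ₖ (((unitCovB L (fine (Lb * 1) (cubic (d + 1) (s t))) a ha k)⁻¹ * (((flucCov (reM (DelK (lev L k) (one_le_lev' L k) (fine (Lb * 1) (cubic (d + 1) (s t))) a ha)) (Matrix.fromRows (reM (QB 1 Lb (cubic (d + 1) (s t)))) (fun (t' : {x : Tor (fine (Lb * 1) (cubic (d + 1) (s t))) × Fin (d + 1) // (∀ ν, ν < x.2 → ((rem 1 Lb (cubic (d + 1) (s t)) x.1 ν : ℕ)) = 0) ∧ ((rem 1 Lb (cubic (d + 1) (s t)) x.1 x.2 : ℕ)) + 1 < Lb}) (x : Tor (fine (Lb * 1) (cubic (d + 1) (s t))) × Fin (d + 1)) => if x = (Function.Embedding.subtype (fun x : Tor (fine (Lb * 1) (cubic (d + 1) (s t))) × Fin (d + 1) => (∀ ν, ν < x.2 → ((rem 1 Lb (cubic (d + 1) (s t)) x.1 ν : ℕ)) = 0) ∧ ((rem 1 Lb (cubic (d + 1)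 (s t)) x.1 x.2 : ℕ)) + 1 < Lb)) t' then (1 : ℝ) else 0))).map ((↑) : ℝ → ℂ)).submatrix (unitIdx L (fine (Lb * 1) (cubic (d + 1) (s t)))) (unitIdx L (fine (Lb * 1) (cubic (d + 1) (s t))))) * (unitCovB L (fine (Lb * 1) (cubic (d + 1) (s t))) a ha k)⁻¹))ᵀ) * (Γ₂ t k)ᴴ) (γ₁ * γ₂ * C) (κ₁ / 4)) ∧
      (∀ t, TwoLevelDecayRate (distK L (fine (Lb * 1) (cubic (d + 1) (s t)))) (fun k => Γ₁ t k * ((unitCovB L (fine (Lb * 1) (cubic (d + 1) (s t))) a ha k)⁻¹ ⊗ₖ (((unitCovB L (fine (Lb * 1) (cubic (d + 1) (s t))) a ha k)⁻¹ * (((flucCov (reM (DelK (lev L k) (one_le_lev' L k) (fine (Lb * 1) (cubic (d + 1) (s t))) a ha)) (Matrix.fromRows (reM (QB 1 Lb (cubic (d + 1) (s t)))) (fun (t' : {x : Tor (fine (Lb * 1) (cubic (d + 1) (s t))) × Fin (d + 1) // (∀ ν, ν < x.2 → ((rem 1 Lb (cubic (d + 1) (s t)) x.1 ν : ℕ)) =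 0) ∧ ((rem 1 Lb (cubic (d + 1) (s t)) x.1 x.2 : ℕ)) + 1 < Lb}) (x : Tor (fine (Lb * 1) (cubic (d + 1) (s t))) × Fin (d + 1)) => if x = (Function.Embedding.subtype (fun x : Tor (fine (Lb * 1) (cubic (d + 1) (s t))) × Fin (d + 1) => (∀ ν, ν < x.2 → ((rem 1 Lb (cubic (d + 1) (s t)) x.1 ν : ℕ)) = 0) ∧ ((rem 1 Lb (cubic (d + 1) (s t)) x.1 x.2 : ℕ)) + 1 < Lb)) t' then (1 : ℝ) else 0))).map ((↑) : ℝ → ℂ)).submatrix (unitIdx L (fine (Lb * 1) (cubic (d + 1) (s t)))) (unitIdx L (fine (Lb * 1) (cubic (d + 1) (s t))))) * (unitCovB L (fine (Lb * 1) (cubic (d + 1) (s t))) a ha k)⁻¹))ᵀ) * (Γ₂ t k)ᴴ) (((γ₁' * γ₂ + γ₁ * γ₂') * C + γ₁ * γ₂ * C')) (κ₁ / 4) θ) ∧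
      (∀ k (μ ν : Fin (d + 1)) (z z' : Fin (d + 1) → ℤ), ∃ s' : ℂ, Tendsto (fun t => (Γ₁ t k * ((unitCovB L (fine (Lb * 1) (cubic (d + 1) (s t))) a ha k)⁻¹ ⊗ₖ (((unitCovB L (fine (Lb * 1) (cubic (d + 1) (s t))) a ha k)⁻¹ * (((flucCov (reM (DelK (lev L k) (one_le_lev' L k) (fine (Lb * 1) (cubic (d + 1) (s t))) a ha)) (Matrix.fromRows (reM (QB 1 Lb (cubic (d + 1) (s t)))) (fun (t' : {x : Tor (fine (Lb * 1) (cubic (d + 1) (s t))) × Fin (d + 1) // (∀ ν, ν < x.2 → ((rem 1 Lb (cubic (d + 1) (s t)) x.1 ν : ℕ)) = 0) ∧ ((rem 1 Lb (cubic (d + 1) (s t)) x.1 x.2 : ℕ)) + 1 < Lb}) (x : Tor (fine (Lb * 1) (cubic (d + 1) (s t))) × Fin (d + 1)) => if x = (Function.Embedding.subtype (fun x : Tor (fine (Lb * 1) (cubic (d + 1) (s t))) × Fin (d + 1) => (∀ ν, ν < x.2 → ((rem 1 Lb (cubic (d + 1) (s t)) x.1 ν : ℕ)) = 0) ∧ ((rem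 1 Lb (cubic (d + 1) (s t)) x.1 x.2 : ℕ)) + 1 < Lb)) t' then (1 : ℝ) else 0))).map ((↑) : ℝ → ℂ)).submatrix (unitIdx L (fine (Lb * 1) (cubic (d + 1) (s t)))) (unitIdx L (fine (Lb * 1) (cubic (d + 1) (s t))))) * (unitCovB L (fine (Lb * 1) (cubic (d + 1) (s t))) a ha k)⁻¹))ᵀ) * (Γ₂ t k)ᴴ) ((unitIdx L (fine (Lb * 1) (cubic (d + 1) (s t)))).symm (castT (fine (Lb * 1) (cubic (d + 1) (s t))) z, μ)) ((unitIdx L (fine (Lb * 1) (cubic (d + 1) (s t)))).symm (castT (fine (Lb * 1) (cubic (d + 1) (s t))) z', ν))) atTop (𝓝 s')) := by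
  have hd' : 2 ≤ d + 1 := by omega
  have hθ0 : 0 ≤ Real.sqrt ((L : ℝ)⁻¹) := Real.sqrt_nonneg _
  have hθ1 : 0 ≤ θ := hθ0.trans hθL
  have hside : Tendsto (fun t => Lb * 1 * s t) atTop atTop :=
    Filter.tendsto_atTop_mono (fun t => Nat.le_mul_of_pos_left _ (Nat.pos_of_ne_zero (NeZero.ne (Lb * 1)))) hs
  obtain ⟨κ₀, B₁, B₁', hκ₀, hB₁, hudY, hsrY, helY⟩ := exists_loopCov_inputs L a ha Lb s hL hd hs one_pos
  have hB₁' : 0 ≤ B₁' := by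
    haveI : Nonempty (idx L (fine (Lb * 1) (cubic (d + 1) (s 0))) 0) := ⟨(unitIdx L _).symm (0, 0)⟩
    exact twoLevelDecayRate_const_nonneg (hsrY 0)
  have hsrY1 := fun t => twoLevelDecayRate_of_le_ratio (hsrY t) hB₁' hθ0 hθL
  obtain ⟨κ', Bs, B₂', hκ', hBs, hB₂', hudZ, hsrZ, helZ⟩ := inv_unitCovB_inputs L a ha hL hd (fun t => Lb * 1 * s t) hside
  have hB₂ : 0 ≤ Bs + ‖(a : ℂ)‖ * 1 := by positivity
  have hsrZ1 := fun t => twoLevelDecayRate_of_le_ratio (hsrZ t) hB₂' hθ0 hθL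
  have hYT := inputs_transpose L (side := fun t => Lb * 1 * s t) (c := fun t k => ((unitCovB L (fine (Lb * 1) (cubic (d + 1) (s t))) a ha k)⁻¹ * (((flucCov (reM (DelK (lev L k) (one_le_lev' L k) (fine (Lb * 1) (cubic (d + 1) (s t))) a ha)) (Matrix.fromRows (reM (QB 1 Lb (cubic (d + 1) (s t)))) (fun (t' : {x : Tor (fine (Lb * 1) (cubic (d + 1) (s t))) × Fin (d + 1) // (∀ ν, ν < x.2 → ((rem 1 Lb (cubic (d + 1) (s t)) x.1 ν : ℕ)) = 0) ∧ ((rem 1 Lb (cubic (d + 1) (s t)) x.1 x.2 : ℕ)) + 1 < Lb}) (x : Tor (fine (Lb * 1) (cubic (d + 1) (s t))) × Fin (d + 1)) => if x = (Function.Embedding.subtype (fun x : Tor (fine (Lb * 1) (cubic (d + 1) (s t))) × Fin (d + 1) => (∀ ν, ν < x.2 → ((rem 1 Lb (cubic (d + 1) (s t)) x.1 ν : ℕ)) = 0) ∧ ((rem 1 Lb (cubic (d + 1) (s t)) x.1 x.2 : ℕ)) + 1 < Lb)) t' then (1 : ℝ) else 0))).map ((↑) : ℝ → ℂ)).submatrix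 (unitIdx L (fine (Lb * 1) (cubic (d + 1) (s t)))) (unitIdx L (fine (Lb * 1) (cubic (d + 1) (s t))))) * (unitCovB L (fine (Lb * 1) (cubic (d + 1) (s t))) a ha k)⁻¹)) ⟨hudY, hsrY1, helY⟩
  obtain ⟨C, C', hC, hC', h⟩ := inputs_twoKernel_of_bundles L (d := d + 1) hd' hside (K₁ := fun t k => (unitCovB L (fine (Lb * 1) (cubic (d + 1) (s t))) a ha k)⁻¹) (K₂ := fun t k => (((unitCovB L (fine (Lb * 1) (cubic (d + 1) (s t))) a ha k)⁻¹ * (((flucCov (reM (DelK (lev L k) (one_le_lev' L k) (fine (Lb * 1) (cubic (d + 1) (s t))) a ha)) (Matrix.fromRows (reM (QB 1 Lb (cubic (d + 1) (s t)))) (fun (t' : {x : Tor (fine (Lb * 1) (cubic (d + 1) (s t))) × Fin (d + 1) // (∀ ν, ν < x.2 → ((rem 1 Lb (cubic (d + 1) (s t)) x.1 ν : ℕ)) = 0) ∧ ((rem 1 Lb (cubic (d + 1) (s t)) x.1 x.2 : ℕ)) + 1 < Lb}) (x : Tor (fine (Lb * 1) (cubic (d + 1) (s t))) × Fin (d + 1))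 => if x = (Function.Embedding.subtype (fun x : Tor (fine (Lb * 1) (cubic (d + 1) (s t))) × Fin (d + 1) => (∀ ν, ν < x.2 → ((rem 1 Lb (cubic (d + 1) (s t)) x.1 ν : ℕ)) = 0) ∧ ((rem 1 Lb (cubic (d + 1) (s t)) x.1 x.2 : ℕ)) + 1 < Lb)) t' then (1 : ℝ) else 0))).map ((↑) : ℝ → ℂ)).submatrix (unitIdx L (fine (Lb * 1) (cubic (d + 1) (s t)))) (unitIdx L (fine (Lb * 1) (cubic (d + 1) (s t))))) * (unitCovB L (fine (Lb * 1) (cubic (d + 1) (s t))) a ha k)⁻¹))ᵀ)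
    hκ' hκ₀ hκΓ hB₂ hB₂' hB₁ hB₁' hθ1 ⟨hudZ, hsrZ1, helZ⟩ hYT
  exact ⟨min (min κ' κ₀) κΓ, C, C', lt_min (lt_min hκ' hκ₀) hκΓ, min_le_right _ _, hC, hC', h⟩

/-- **`inputs_loopInvT_moving_of_ratio` — THE SOCKET `Γ₁(Y ⊗ₖ (c⁻¹)ᵀ)Γ₂ᴴ` OF THE ONE-LOOP STEP WITH LEVEL-DEPENDENT LEGS OF STEP RATIO `θ` IS A RATIO-`θ` INPUT BUNDLE** (dimension
`d + 1 ≥ 2`, `L ≥ 2`, every `Lb ≥ 1`, `a > 0`, every cubic coarse volume sequence `s t → ∞`; the legs' rate `κ_Γ > 0` PRESCRIBED, their step envelope `γᵢ′·θ^k·e^{−κ_Γ(…)}`, ANY `θ ≥ √(L⁻¹)`):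
`∃ 0 < κ₁ ≤ κ_Γ`, `C, C′ ≥ 0` such that for all such legs with EL₃ the socket tower has (UD) `(γ₁γ₂C, κ₁∕4)`, (SR) `((γ₁′γ₂ + γ₁γ₂′)C + γ₁γ₂C′, κ₁∕4, θ)` and (EL) at ALL integer root
pairs — PART 208 §2 with the loop covariance's ∕ `c⁻¹`'s ratio `√(L⁻¹)` weakened to `θ`. [cite: Balaban1987RG1, (1.20)–(1.22) p.264 (shapes)] [folklore] -/
theorem inputs_loopInvT_moving_of_ratio (hL : 2 ≤ L) (hd : 1 ≤ d) (hs : Tendsto s atTop atTop) {κΓ : ℝ} (hκΓ : 0 < κΓ) {θ : ℝ} (hθL : Real.sqrt ((L : ℝ)⁻¹) ≤ θ) :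
    ∃ κ₁ C C' : ℝ, 0 < κ₁ ∧ κ₁ ≤ κΓ ∧ 0 ≤ C ∧ 0 ≤ C' ∧ ∀ (γ₁ γ₂ γ₁' γ₂' : ℝ), 0 ≤ γ₁ → 0 ≤ γ₂ → 0 ≤ γ₁' → 0 ≤ γ₂' →
      ∀ (Γ₁ Γ₂ : (t k : ℕ) → Matrix (idx L (fine (Lb * 1) (cubic (d + 1) (s t))) 0) (idx L (fine (Lb * 1) (cubic (d + 1) (s t))) 0 × idx L (fine (Lb * 1) (cubic (d + 1) (s t))) 0) ℂ),
      (∀ t k x q, ‖Γ₁ t k x q‖ ≤ γ₁ * Real.exp (-(κΓ * (distK L (fine (Lb * 1) (cubic (d + 1) (s t))) x q.1 + distK L (fine (Lb * 1) (cubic (d + 1) (s t))) x q.2)))) →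
      (∀ t k x q, ‖Γ₂ t k x q‖ ≤ γ₂ * Real.exp (-(κΓ * (distK L (fine (Lb * 1) (cubic (d + 1) (s t))) x q.1 + distK L (fine (Lb * 1) (cubic (d + 1) (s t))) x q.2)))) →
      (∀ t k x q, ‖(Γ₁ t (k + 1) - Γ₁ t k) x q‖ ≤ γ₁' * θ ^ k * Real.exp (-(κΓ * (distK L (fine (Lb * 1) (cubic (d + 1) (s t))) x q.1 + distK L (fine (Lb * 1) (cubic (d + 1) (s t))) x q.2)))) →
      (∀ t k x q, ‖(Γ₂ t (k + 1) - Γ₂ t k) x q‖ ≤ γ₂' * θ ^ k * Real.exp (-(κΓ * (distK L (fine (Lb * 1) (cubic (d + 1) (s t))) x q.1 + distK L (fine (Lb * 1) (cubic (d + 1) (s t))) x q.2)))) →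
      (∀ k (μ' l l' : Fin (d + 1)) (z u v : Fin (d + 1) → ℤ), ∃ s' : ℂ, Tendsto (fun t => Γ₁ t k ((unitIdx L (fine (Lb * 1) (cubic (d + 1) (s t)))).symm (castT (fine (Lb * 1) (cubic (d + 1) (s t))) z, μ')) (((unitIdx L (fine (Lb * 1) (cubic (d + 1) (s t)))).symm (castT (fine (Lb * 1) (cubic (d + 1) (s t))) u, l)), ((unitIdx L (fine (Lb * 1) (cubic (d + 1) (s t)))).symm (castT (fine (Lb * 1) (cubic (d + 1) (s t))) v, l')))) atTop (𝓝 s')) →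
      (∀ k (μ' l l' : Fin (d + 1)) (z u v : Fin (d + 1) → ℤ), ∃ s' : ℂ, Tendsto (fun t => Γ₂ t k ((unitIdx L (fine (Lb * 1) (cubic (d + 1) (s t)))).symm (castT (fine (Lb * 1) (cubic (d + 1) (s t))) z, μ')) (((unitIdx L (fine (Lb * 1) (cubic (d + 1) (s t)))).symm (castT (fine (Lb * 1) (cubic (d + 1) (s t))) u, l)), ((unitIdx L (fine (Lb * 1) (cubic (d + 1) (s t)))).symm (castT (fine (Lb * 1) (cubic (d + 1) (s t))) v, l')))) atTop (𝓝 s')) →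
      (∀ t k, EntryDecay (distK L (fine (Lb * 1) (cubic (d + 1) (s t)))) (Γ₁ t k * ((((unitCovB L (fine (Lb * 1) (cubic (d + 1) (s t))) a ha k)⁻¹ * (((flucCov (reM (DelK (lev L k) (one_le_lev' L k) (fine (Lb * 1) (cubic (d + 1) (s t))) a ha)) (Matrix.fromRows (reM (QB 1 Lb (cubic (d + 1) (s t)))) (fun (t' : {x : Tor (fine (Lb * 1) (cubic (d + 1) (s t))) × Fin (d + 1) // (∀ ν, ν < x.2 → ((rem 1 Lb (cubic (d + 1) (s t)) x.1 ν : ℕ)) = 0) ∧ ((rem 1 Lb (cubic (d + 1) (s t)) x.1 x.2 : ℕ)) + 1 < Lb}) (x : Tor (fine (Lb * 1) (cubic (d + 1) (s t))) × Fin (d + 1)) => if x = (Function.Embedding.subtype (fun x : Tor (fine (Lb * 1) (cubic (d + 1) (s t))) × Fin (d + 1) => (∀ ν, ν < x.2 → ((rem 1 Lb (cubic (d + 1) (s t)) x.1 ν : ℕ)) = 0) ∧ ((rem 1 Lb (cubic (d + 1) (s t)) x.1 x.2 : ℕ)) + 1 < Lb)) t' then (1 : ℝ) else 0))).map ((↑)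 : ℝ → ℂ)).submatrix (unitIdx L (fine (Lb * 1) (cubic (d + 1) (s t)))) (unitIdx L (fine (Lb * 1) (cubic (d + 1) (s t))))) * (unitCovB L (fine (Lb * 1) (cubic (d + 1) (s t))) a ha k)⁻¹)) ⊗ₖ ((unitCovB L (fine (Lb * 1) (cubic (d + 1) (s t))) a ha k)⁻¹)ᵀ) * (Γ₂ t k)ᴴ) (γ₁ * γ₂ * C) (κ₁ / 4)) ∧
      (∀ t, TwoLevelDecayRate (distK L (fine (Lb * 1) (cubic (d + 1) (s t)))) (fun k => Γ₁ t k * ((((unitCovB L (fine (Lb * 1) (cubic (d + 1) (s t))) a ha k)⁻¹ * (((flucCov (reM (DelK (lev L k) (one_le_lev' L k) (fine (Lb * 1) (cubic (d + 1) (s t))) a ha)) (Matrix.fromRows (reM (QB 1 Lb (cubic (d + 1) (s t)))) (fun (t' : {x : Tor (fine (Lb * 1) (cubic (d + 1) (s t))) × Fin (d + 1) // (∀ ν, ν < x.2 → ((rem 1 Lb (cubic (d + 1) (s t)) x.1 ν : ℕ)) = 0) ∧ ((rem 1 Lb (cubic (d + 1) (s t)) x.1 x.2 : ℕ)) + 1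 < Lb}) (x : Tor (fine (Lb * 1) (cubic (d + 1) (s t))) × Fin (d + 1)) => if x = (Function.Embedding.subtype (fun x : Tor (fine (Lb * 1) (cubic (d + 1) (s t))) × Fin (d + 1) => (∀ ν, ν < x.2 → ((rem 1 Lb (cubic (d + 1) (s t)) x.1 ν : ℕ)) = 0) ∧ ((rem 1 Lb (cubic (d + 1) (s t)) x.1 x.2 : ℕ)) + 1 < Lb)) t' then (1 : ℝ) else 0))).map ((↑) : ℝ → ℂ)).submatrix (unitIdx L (fine (Lb * 1) (cubic (d + 1) (s t)))) (unitIdx L (fine (Lb * 1) (cubic (d + 1) (s t))))) * (unitCovB L (fine (Lb * 1) (cubic (d + 1) (s t))) a ha k)⁻¹)) ⊗ₖ ((unitCovB L (fine (Lb * 1) (cubic (d + 1) (s t))) a ha k)⁻¹)ᵀ) * (Γ₂ t k)ᴴ) (((γ₁' * γ₂ + γ₁ * γ₂') * C + γ₁ * γ₂ * C')) (κ₁ / 4) θ) ∧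
      (∀ k (μ ν : Fin (d + 1)) (z z' : Fin (d + 1) → ℤ), ∃ s' : ℂ, Tendsto (fun t => (Γ₁ t k * ((((unitCovB L (fine (Lb * 1) (cubic (d + 1) (s t))) a ha k)⁻¹ * (((flucCov (reM (DelK (lev L k) (one_le_lev' L k) (fine (Lb * 1) (cubic (d + 1) (s t))) a ha)) (Matrix.fromRows (reM (QB 1 Lb (cubic (d + 1) (s t)))) (fun (t' : {x : Tor (fine (Lb * 1) (cubic (d + 1) (s t))) × Fin (d + 1) // (∀ ν, ν < x.2 → ((rem 1 Lb (cubic (d + 1) (s t)) x.1 ν : ℕ)) = 0) ∧ ((rem 1 Lb (cubic (d + 1) (s t)) x.1 x.2 : ℕ)) + 1 < Lb}) (x : Tor (fine (Lb * 1) (cubic (d + 1) (s t))) × Fin (d + 1)) => if x = (Function.Embedding.subtype (fun x : Tor (fine (Lb * 1) (cubic (d + 1) (s t))) × Fin (d + 1) => (∀ ν, ν < x.2 → ((rem 1 Lb (cubic (d + 1) (s t)) x.1 ν : ℕ)) = 0) ∧ ((rem 1 Lb (cubic (d + 1) (s t)) x.1 x.2 : ℕ)) + 1 < Lb)) t' then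 (1 : ℝ) else 0))).map ((↑) : ℝ → ℂ)).submatrix (unitIdx L (fine (Lb * 1) (cubic (d + 1) (s t)))) (unitIdx L (fine (Lb * 1) (cubic (d + 1) (s t))))) * (unitCovB L (fine (Lb * 1) (cubic (d + 1) (s t))) a ha k)⁻¹)) ⊗ₖ ((unitCovB L (fine (Lb * 1) (cubic (d + 1) (s t))) a ha k)⁻¹)ᵀ) * (Γ₂ t k)ᴴ) ((unitIdx L (fine (Lb * 1) (cubic (d + 1) (s t)))).symm (castT (fine (Lb * 1) (cubic (d + 1) (s t))) z, μ)) ((unitIdx L (fine (Lb * 1) (cubic (d + 1) (s t)))).symm (castT (fine (Lb * 1) (cubic (d + 1) (s t))) z', ν))) atTop (𝓝 s')) := by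
  have hd' : 2 ≤ d + 1 := by omega
  have hθ0 : 0 ≤ Real.sqrt ((L : ℝ)⁻¹) := Real.sqrt_nonneg _
  have hθ1 : 0 ≤ θ := hθ0.trans hθL
  have hside : Tendsto (fun t => Lb * 1 * s t) atTop atTop :=
    Filter.tendsto_atTop_mono (fun t => Nat.le_mul_of_pos_left _ (Nat.pos_of_ne_zero (NeZero.ne (Lb * 1)))) hs
  obtain ⟨κ₀, B₁, B₁', hκ₀, hB₁, hudY, hsrY, helY⟩ := exists_loopCov_inputs L a ha Lb s hL hd hs one_pos
  have hB₁' : 0 ≤ B₁' := by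
    haveI : Nonempty (idx L (fine (Lb * 1) (cubic (d + 1) (s 0))) 0) := ⟨(unitIdx L _).symm (0, 0)⟩
    exact twoLevelDecayRate_const_nonneg (hsrY 0)
  have hsrY1 := fun t => twoLevelDecayRate_of_le_ratio (hsrY t) hB₁' hθ0 hθL
  obtain ⟨κ', Bs, B₂', hκ', hBs, hB₂', hudZ, hsrZ, helZ⟩ := inv_unitCovB_inputs L a ha hL hd (fun t => Lb * 1 * s t) hside
  have hB₂ : 0 ≤ Bs + ‖(a : ℂ)‖ * 1 := by positivity
  have hsrZ1 := fun t => twoLevelDecayRate_of_le_ratio (hsrZ t) hB₂' hθ0 hθL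
  have hZT := inputs_transpose L (side := fun t => Lb * 1 * s t) (c := fun t k => (unitCovB L (fine (Lb * 1) (cubic (d + 1) (s t))) a ha k)⁻¹) ⟨hudZ, hsrZ1, helZ⟩
  obtain ⟨C, C', hC, hC', h⟩ := inputs_twoKernel_of_bundles L (d := d + 1) hd' hside (K₁ := fun t k => ((unitCovB L (fine (Lb * 1) (cubic (d + 1) (s t))) a ha k)⁻¹ * (((flucCov (reM (DelK (lev L k) (one_le_lev' L k) (fine (Lb * 1) (cubic (d + 1) (s t))) a ha)) (Matrix.fromRows (reM (QB 1 Lb (cubic (d + 1) (s t)))) (fun (t' : {x : Tor (fine (Lb * 1) (cubic (d + 1) (s t))) × Fin (d + 1) // (∀ ν, ν < x.2 → ((rem 1 Lb (cubic (d + 1) (s t)) x.1 ν : ℕ)) = 0) ∧ ((rem 1 Lb (cubic (d + 1) (s t)) x.1 x.2 : ℕ)) + 1 < Lb}) (x : Tor (fine (Lb * 1) (cubic (d + 1) (s t))) × Fin (d + 1)) => if x = (Function.Embedding.subtype (fun x : Tor (fine (Lb * 1) (cubic (d + 1) (s t))) × Fin (d + 1) => (∀ ν, ν < x.2 → ((rem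 1 Lb (cubic (d + 1) (s t)) x.1 ν : ℕ)) = 0) ∧ ((rem 1 Lb (cubic (d + 1) (s t)) x.1 x.2 : ℕ)) + 1 < Lb)) t' then (1 : ℝ) else 0))).map ((↑) : ℝ → ℂ)).submatrix (unitIdx L (fine (Lb * 1) (cubic (d + 1) (s t)))) (unitIdx L (fine (Lb * 1) (cubic (d + 1) (s t))))) * (unitCovB L (fine (Lb * 1) (cubic (d + 1) (s t))) a ha k)⁻¹)) (K₂ := fun t k => ((unitCovB L (fine (Lb * 1) (cubic (d + 1) (s t))) a ha k)⁻¹)ᵀ)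
    hκ₀ hκ' hκΓ hB₁ hB₁' hB₂ hB₂' hθ1 ⟨hudY, hsrY1, helY⟩ hZT
  exact ⟨min (min κ₀ κ') κΓ, C, C', lt_min (lt_min hκ₀ hκ') hκΓ, min_le_right _ _, hC, hC', h⟩

end Moving

end Summit.QuantumFields.BalabanUV.Beta.GAN24.SecondOrderRatioSockets

end
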